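/-
Copyright (c) 2026 the pub-hodgecm-mathlib formalisation cell (harness21).  Prover seat hodgecm-mathlib-K2E2-p12 (g6): Track B «K2-LIT», ENGINE E1,
h413 = stmt-HodgeConjecture-24833; line `K2_E1_TraceFormulaBeta`, 5Res campaign «ENDGAME BY FAMILIES», amendment #3 G8, ruling (270)∕14:3xZ of K2E1-plan (g7):
FILE 2 of the letter `hsymm_τ` — the E1 plug of ★ FILE 1 (p860867) at `U(J₂)`: for a SELF-DUAL `χ` the symbol of a Hecke operator on the `(χ, K′, ω)`-sections satisfies `s(z) = s(1 − z)`,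
modulo ONE visible letter (non-vanishing of the intertwined section at one point of the half-plane).
-/
import Summits.HodgeConjecture.HodgeConjecture.Theorems.K2E1ArchSphericalTypeSymbolWeylSymmetryU2   -- ★ FILE 1 p860867 (this seat): `symbol_symm_of_selfDual`
import Summits.HodgeConjecture.HodgeConjecture.Theorems.K2E1ChiIntertwinedSectionU2                 -- ★ row 3 (K2-defs1): `hasReflectedIntertwining_intertwinedCoeff_two`, `isChiSection_intertwinedCoeff_two`
import Summits.HodgeConjecture.HodgeConjecture.Theorems.K2E1ChiSectionSpaceU2Defs                   -- ★ `chiSectionSpace χ K′ ω`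
import Literature.NumberTheory.Automorphic.UnitaryGroupCuspIntegralSiegelMajorant                   -- ★ `borelHeight_mul_of_mem_comap_standardMaximalCompactGL`
import HarnessLib

/-!
# K2·E1 — `K2E1ChiSymbolWeylSymmetrySelfDualU2` (G8 FILE 2): FOR A SELF-DUAL `χ` (`χʷ = χ`) THE HECKE SYMBOL ON THE `(χ, K′, ω)`-SECTIONS OF `U(J₂)` SATISFIES `s(z) = s(1 − z)`, HENCE
# `hsymm : s(½ − it) = s(½ + it)` — ★ FILE 1 with `hR ∕ hR′` (the symbol), `hscale` (★ row 3: `M(z)φ` is a `χʷ = χ`-section, `∫_N f_z^φ(Wvg) dν = f_{1−z}^{M(z)φ}(g)`) PLUGGED; ONE visible letter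
# `hMne` (the intertwined section is non-zero at one point `Re w₁ > 1`) + the Fubini∕continuity letters [Mœglin–Waldspurger II.1.6–7, IV.1.10; Garrett §2.8]

Track B ∕ K2-LIT, crux h413 = `stmt-HodgeConjecture-24833`, route of record `HCCMUnconditional`; cell `hodgecm-mathlib`, squad K2, ENGINE E1 (5Res campaign, amendment #3 «general (U,τ) ladder» rung
G8: the letter `hsymm_τ` of (y1-c)∕G9; generic `N = 2` quasi-split datum `(F, E, c)` with `c² = 1`, `c ≠ 1`).  THEOREMS ONLY (no `def`, no `instance`, no notation, no named-fact hypothesis, no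
`sorry`; default heartbeats); lane `--supports stmt-HodgeConjecture-24833 --as helper` (count-neutral).  CLOSES NO SOCKET.
THE INPUTS.  `φ ∈ V = chiSectionSpace χ K′ ω` Borel-measurable, `K′ ≤ K_U` (so `H` is right-`K′`-invariant); a kernel `h` and an ENTIRE `s` with the symbol law
`hR : ∀ z, ∀ ψ ∈ V, ∀ x, ∫ h(y) f_z^ψ(x y) dν_G = s(z)·f_z^ψ(x)` — EXACTLY the output of ★ P1 `K2E1ArchTestFunctionSymbolU2.exists_entire_symbol_of_arch` for a `K_∞`-central pure tensor
`h_∞ ⊗ 𝟙_U` (every `K_∞`-character `τ` encoded in `ω`); `χ` SELF-DUAL `reflectChar c χ = χ` (so `M(z)φ ∈ V` again: §1); the letters `hint` (Fubini integrability of `h(y)·f_w^φ(W v g y)` on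
`ν_G ⊗ ν` for `Re w > 1` — ★ K2E1-p10's pattern in `K2E1SphericalTransformSymmetryU` §1), `hcontM` (continuity of `w ↦ ∫_N f_w^φ(W v g) dν` on `{Re w > 1}` — ★
`continuousOn_intertwiningIntegral_flatSectionU` for bounded measurable `φ`), and THE ONE REAL LETTER `hMne : ∃ w₁, 1 < re w₁ ∧ ∫_N f_{w₁}^φ(W v g) dν ≠ 0` (non-vanishing of `M(w₁)φ` at `g`;
payer: injectivity of `M(w₁)` from the matrix functional equation `M(1−w)M(w) = id`, K2E4-p10's G8 exports; for `τ = 1`, `χ_∞ = 1` it is ★ `c(2) > 0`).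
* §1 `intertwinedCoeff_mem_chiSectionSpace` — for self-dual `χ` and `K′ ≤ K_U`, `M(z)φ·H^{z−1} ∈ V(χ, K′, ω)` (★ row 3 + right-`(K′,ω)`-equivariance).
* §2 **`chi_symbol_symm_of_selfDual`** — `∀ z, s z = s (1 − z)`; **`chi_symbol_hsymm_of_selfDual`** — `∀ t, s(½ − it) = s(½ + it)` (K2E1-p11's (y1-c) byte shape).
HONEST LABEL: HC_CM is proved only modulo the 7 printed citations (2 remaining named inputs: hLiu418 = `stmt-HodgeConjecture-24832`, h413 = `stmt-HodgeConjecture-24833`) until rung 0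
closes; this file asserts no named fact, is conditional by construction on the visible letters `hMne hint hcontM`, and closes no socket; count-neutral.

## References
* [MoeglinWaldspurger1995] C. Mœglin, J.-L. Waldspurger, *Spectral decomposition and Eisenstein series* (1995): II.1.6–II.1.7, IV.1.10.
* [Garrett2018] P. Garrett, *Modern Analysis of Automorphic Forms by Example* (2018): §2.8.
* [Langlands1976] R. P. Langlands, LNM 544 (1976): §6.
-/

set_option autoImplicit false
set_option linter.dupNamespace false -- the mandated namespace repeats `HodgeConjecture.HodgeConjecture`

noncomputable section

open MeasureTheory Measure NumberField Filter Topology Set Function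
open scoped NNReal ENNReal MatrixGroups
open Literature.NumberTheory Literature.NumberTheory.Automorphic Literature.NumberTheory.Automorphic.UnitaryGroup AdelicGroupData
open Literature.NumberTheory.GaloisRepresentations (HeckeCharacter)
open Summit.HodgeConjecture.HodgeConjecture.Cruxes.H413.K2E1BorelEisensteinU
open Summit.HodgeConjecture.HodgeConjecture.Cruxes.H413.K2E1CharacterEisensteinU2Defs
open Summit.HodgeConjecture.HodgeConjecture.Cruxes.H413.K2E1ChiSectionSpaceU2Defs
open Summit.HodgeConjecture.HodgeConjecture.Cruxes.H413.K2E1ChiIntertwinedSectionU2 (hasReflectedIntertwining_intertwinedCoeff_two isChiSection_intertwinedCoeff_two)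
open Summit.HodgeConjecture.HodgeConjecture.Cruxes.H413.K2E1ArchSphericalTypeSymbolWeylSymmetryU2 (symbol_symm_of_selfDual)

namespace Summit.HodgeConjecture.HodgeConjecture.Cruxes.H413.K2E1ChiSymbolWeylSymmetrySelfDualU2

variable {F E : Type} [Field F] [NumberField F] [Field E] [NumberField E] [Algebra F E] {c : E ≃ₐ[F] E}
  [MeasurableSpace (quasiSplit F E c 2).Adelic] [BorelSpace (quasiSplit F E c 2).Adelic]

/-! ## §1 For self-dual `χ` the intertwined coefficient `M(z)φ·H^{z−1}` lies again in `V(χ, K′, ω)` -/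

/-- **`M(z)φ · H^{z−1} ∈ V(χ, K′, ω)` FOR SELF-DUAL `χ`**: it is a `χʷ`-section (★ row 3 `isChiSection_intertwinedCoeff_two`) and `χʷ = χ`; right-`(K′, ω)`-equivariance passes under the
`N(𝔸)`-integral because `f_z^φ(y k) = ω(k) f_z^φ(y)` for `k ∈ K′ ≤ K_U` (`H` right-`K_U`-invariant, ★ `borelHeight_mul_of_mem_comap_standardMaximalCompactGL`).
[cite: MoeglinWaldspurger1995, II.1.6–II.1.7] [cite: Garrett2018, §2.8] -/
theorem intertwinedCoeff_mem_chiSectionSpace (hc : c * c = 1) (hc1 : c ≠ 1) (ν : Measure ↥(adelicUnipotent F E c 2)) [ν.IsHaarMeasure]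
    {χ : HeckeCharacter E} (hsd : reflectChar c χ = χ) {K' : Subgroup (quasiSplit F E c 2).Adelic} {ω : ↥K' → ℂ}
    (hK'U : K' ≤ ((standardMaximalCompactGL 2 E).comap (adelicVal F E c 2 ((StdForm.antidiagonal 2).over E)) : Subgroup (quasiSplit F E c 2).Adelic))
    {φ : (quasiSplit F E c 2).Adelic → ℂ} (hφ : φ ∈ chiSectionSpace χ K' ω) (hφm : Measurable φ) (z : ℂ) :
    (fun g : (quasiSplit F E c 2).Adelic =>
      (∫ v : ↥(adelicUnipotent F E c 2), flatSectionU φ z ((quasiSplit F E c 2).toAdelic (weylLongU (c : E →+* E) (rfl : (StdForm.antidiagonal 2).over E = (StdForm.antidiagonal 2).over E)) *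
        ((v : (quasiSplit F E c 2).Adelic) * g)) ∂ν) * (((borelHeight g : ℝ) : ℂ) ^ (z - 1))) ∈ chiSectionSpace χ K' ω := by
  refine (mem_chiSectionSpace_iff _).2 ⟨?_, fun g k => ?_⟩
  · have h := isChiSection_intertwinedCoeff_two hc hc1 ν (isChiSection_of_mem hφ) hφm z
    rw [hsd] at h
    exact h
  · have hkU : (k : (quasiSplit F E c 2).Adelic) ∈ ((standardMaximalCompactGL 2 E).comap (adelicVal F E c 2 ((StdForm.antidiagonal 2).over E)) : Subgroup (quasiSplit F E c 2).Adelic) :=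
      hK'U k.2
    have hint : ∀ v : ↥(adelicUnipotent F E c 2),
        flatSectionU φ z ((quasiSplit F E c 2).toAdelic (weylLongU (c : E →+* E) (rfl : (StdForm.antidiagonal 2).over E = (StdForm.antidiagonal 2).over E)) *
          ((v : (quasiSplit F E c 2).Adelic) * (g * (k : (quasiSplit F E c 2).Adelic)))) =
        ω k * flatSectionU φ z ((quasiSplit F E c 2).toAdelic (weylLongU (c : E →+* E) (rfl : (StdForm.antidiagonal 2).over E = (StdForm.antidiagonal 2).over E)) *
          ((v : (quasiSplit F E c 2).Adelic) * g)) := fun v => by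
      rw [flatSectionU_apply, flatSectionU_apply, ← mul_assoc ((v : (quasiSplit F E c 2).Adelic)), ← mul_assoc _ (↑v * g), apply_mul_of_mem hφ _ k,
        borelHeight_mul_of_mem_comap_standardMaximalCompactGL hkU, mul_assoc]
    rw [integral_congr_ae (Eventually.of_forall hint), integral_const_mul, borelHeight_mul_of_mem_comap_standardMaximalCompactGL hkU, mul_assoc]

/-! ## §2 The Weyl symmetry of the symbol for self-dual `χ` -/

/-- **`s(z) = s(1 − z)` FOR SELF-DUAL `χ`** (G8, every `K_∞`-type encoded in `ω`): `φ ∈ V(χ,K′,ω)` measurable, `K′ ≤ K_U`, the symbol law `hR` (★ `exists_entire_symbol_of_arch`), `s` entire,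
the Fubini letter `hint` and the continuity letter `hcontM` on `{Re w > 1}` at a base point `g`, and the LETTER `hMne` (`M(w₁)φ (g) ≠ 0` for one `Re w₁ > 1`) ⇒ `∀ z, s z = s (1 − z)` — ★ FILE 1
`symbol_symm_of_selfDual` with `A_w = f_w^φ`, `A′_{1−w} = f_{1−w}^{M(w)φ}`, `c ≡ 1` (★ row 3), `Ω = {Re w > 1} ∩ {M(w)φ(g) ≠ 0}`. [cite: MoeglinWaldspurger1995, IV.1.10] [cite: Garrett2018, §2.8] -/
theorem chi_symbol_symm_of_selfDual (hc : c * c = 1) (hc1 : c ≠ 1) (νG : Measure (quasiSplit F E c 2).Adelic) [SFinite νG]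
    (ν : Measure ↥(adelicUnipotent F E c 2)) [ν.IsHaarMeasure] [SFinite ν]
    {χ : HeckeCharacter E} (hsd : reflectChar c χ = χ) {K' : Subgroup (quasiSplit F E c 2).Adelic} {ω : ↥K' → ℂ}
    (hK'U : K' ≤ ((standardMaximalCompactGL 2 E).comap (adelicVal F E c 2 ((StdForm.antidiagonal 2).over E)) : Subgroup (quasiSplit F E c 2).Adelic))
    {φ : (quasiSplit F E c 2).Adelic → ℂ} (hφ : φ ∈ chiSectionSpace χ K' ω) (hφm : Measurable φ)
    (h : (quasiSplit F E c 2).Adelic → ℂ) (s : ℂ → ℂ) (hs : Differentiable ℂ s)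
    (hR : ∀ (z : ℂ), ∀ ψ ∈ chiSectionSpace χ K' ω, ∀ x : (quasiSplit F E c 2).Adelic, ∫ y, h y * flatSectionU ψ z (x * y) ∂νG = s z * flatSectionU ψ z x)
    (g : (quasiSplit F E c 2).Adelic)
    (hint : ∀ w : ℂ, 1 < w.re → Integrable (uncurry fun (y : (quasiSplit F E c 2).Adelic) (v : ↥(adelicUnipotent F E c 2)) =>
      h y * flatSectionU φ w ((quasiSplit F E c 2).toAdelic (weylLongU (c : E →+* E) (rfl : (StdForm.antidiagonal 2).over E = (StdForm.antidiagonal 2).over E)) *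
        (v : (quasiSplit F E c 2).Adelic) * (g * y))) (νG.prod ν))
    (hcontM : ContinuousOn (fun w : ℂ => ∫ v : ↥(adelicUnipotent F E c 2), flatSectionU φ w ((quasiSplit F E c 2).toAdelic (weylLongU (c : E →+* E)
      (rfl : (StdForm.antidiagonal 2).over E = (StdForm.antidiagonal 2).over E)) * ((v : (quasiSplit F E c 2).Adelic) * g)) ∂ν) {w : ℂ | 1 < w.re})
    (hMne : ∃ w₁ : ℂ, 1 < w₁.re ∧ ∫ v : ↥(adelicUnipotent F E c 2), flatSectionU φ w₁ ((quasiSplit F E c 2).toAdelic (weylLongU (c : E →+* E)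
      (rfl : (StdForm.antidiagonal 2).over E = (StdForm.antidiagonal 2).over E)) * ((v : (quasiSplit F E c 2).Adelic) * g)) ∂ν ≠ 0) (z : ℂ) :
    s z = s (1 - z) := by
  set W : (quasiSplit F E c 2).Adelic := (quasiSplit F E c 2).toAdelic (weylLongU (c : E →+* E) (rfl : (StdForm.antidiagonal 2).over E = (StdForm.antidiagonal 2).over E)) with hW
  -- the intertwined coefficient `M(w)φ·H^{w−1}` and the two section families
  set Φ : ℂ → (quasiSplit F E c 2).Adelic → ℂ := fun w x =>
    (∫ v : ↥(adelicUnipotent F E c 2), flatSectionU φ w (W * ((v : (quasiSplit F E c 2).Adelic) * x)) ∂ν) * (((borelHeight x : ℝ) : ℂ) ^ (w - 1)) with hΦ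
  have hΦV : ∀ w, Φ w ∈ chiSectionSpace χ K' ω := fun w => intertwinedCoeff_mem_chiSectionSpace hc hc1 ν hsd hK'U hφ hφm w
  have hrefl : ∀ w x, ∫ v : ↥(adelicUnipotent F E c 2), flatSectionU φ w (W * (v : (quasiSplit F E c 2).Adelic) * x) ∂ν = flatSectionU (Φ w) (1 - w) x := fun w x =>
    (hasReflectedIntertwining_intertwinedCoeff_two hc hc1 ν (isChiSection_of_mem hφ) hφm w).integral_eq x
  set A : ℂ → (quasiSplit F E c 2).Adelic → ℂ := fun w => flatSectionU φ w with hA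
  set A' : ℂ → (quasiSplit F E c 2).Adelic → ℂ := fun u => flatSectionU (Φ (1 - u)) u with hA'
  have hA'w : ∀ w, A' (1 - w) = flatSectionU (Φ w) (1 - w) := fun w => by rw [hA']; simp only [sub_sub_cancel]
  -- the good open set
  set Ω : Set ℂ := {w : ℂ | 1 < w.re} ∩ (fun w : ℂ => ∫ v : ↥(adelicUnipotent F E c 2), flatSectionU φ w (W * ((v : (quasiSplit F E c 2).Adelic) * g)) ∂ν) ⁻¹' {0}ᶜ with hΩ
  have hΩo : IsOpen Ω := hcontM.isOpen_inter_preimage (isOpen_lt continuous_const Complex.continuous_re) isOpen_compl_singleton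
  obtain ⟨w₁, hw₁, hw₁ne⟩ := hMne
  have h0 : ∃ w₁ ∈ Ω, (fun _ : ℂ => (1 : ℂ)) w₁ ≠ 0 := ⟨w₁, ⟨hw₁, hw₁ne⟩, one_ne_zero⟩
  refine symbol_symm_of_selfDual νG ν (fun v : ↥(adelicUnipotent F E c 2) => (v : (quasiSplit F E c 2).Adelic)) W g h A A' s (fun _ => (1 : ℂ)) 1 hs hΩo
    continuousOn_const h0 ?_ ?_ ?_ ?_ ?_ z
  · -- hR on V(χ)
    intro w _ x
    exact hR w φ hφ x
  · -- hR′ on V(χʷ) = V(χ) at the reflected section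
    intro w _ x
    rw [hA'w]
    exact hR (1 - w) (Φ w) (hΦV w) x
  · -- hscale with c ≡ 1 (★ row 3)
    intro w _ x
    rw [one_mul, hA'w]
    exact hrefl w x
  · -- Fubini letter
    intro w hw
    have e : (uncurry fun (y : (quasiSplit F E c 2).Adelic) (v : ↥(adelicUnipotent F E c 2)) => h y * A w (W * (v : (quasiSplit F E c 2).Adelic) * (g * y))) =
        uncurry fun (y : (quasiSplit F E c 2).Adelic) (v : ↥(adelicUnipotent F E c 2)) => h y * flatSectionU φ w (W * (v : (quasiSplit F E c 2).Adelic) * (g * y)) := rfl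
    rw [e]
    exact hint w hw.1
  · -- hA′: the intertwined section does not vanish at `g` on `Ω`
    intro w hw
    rw [hA'w, ← hrefl w g]
    have hw2 : (∫ v : ↥(adelicUnipotent F E c 2), flatSectionU φ w (W * ((v : (quasiSplit F E c 2).Adelic) * g)) ∂ν) ≠ 0 := hw.2
    simpa only [mul_assoc] using hw2

/-- **`hsymm` FOR SELF-DUAL `χ`** — K2E1-p11's (y1-c) byte shape: `∀ t, s(½ − it) = s(½ + it)`. [cite: MoeglinWaldspurger1995, IV.1.10] [cite: Garrett2018, §2.8] -/
theorem chi_symbol_hsymm_of_selfDual (hc : c * c = 1) (hc1 : c ≠ 1) (νG : Measure (quasiSplit F E c 2).Adelic) [SFinite νG]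
    (ν : Measure ↥(adelicUnipotent F E c 2)) [ν.IsHaarMeasure] [SFinite ν]
    {χ : HeckeCharacter E} (hsd : reflectChar c χ = χ) {K' : Subgroup (quasiSplit F E c 2).Adelic} {ω : ↥K' → ℂ}
    (hK'U : K' ≤ ((standardMaximalCompactGL 2 E).comap (adelicVal F E c 2 ((StdForm.antidiagonal 2).over E)) : Subgroup (quasiSplit F E c 2).Adelic))
    {φ : (quasiSplit F E c 2).Adelic → ℂ} (hφ : φ ∈ chiSectionSpace χ K' ω) (hφm : Measurable φ)
    (h : (quasiSplit F E c 2).Adelic → ℂ) (s : ℂ → ℂ) (hs : Differentiable ℂ s)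
    (hR : ∀ (z : ℂ), ∀ ψ ∈ chiSectionSpace χ K' ω, ∀ x : (quasiSplit F E c 2).Adelic, ∫ y, h y * flatSectionU ψ z (x * y) ∂νG = s z * flatSectionU ψ z x)
    (g : (quasiSplit F E c 2).Adelic)
    (hint : ∀ w : ℂ, 1 < w.re → Integrable (uncurry fun (y : (quasiSplit F E c 2).Adelic) (v : ↥(adelicUnipotent F E c 2)) =>
      h y * flatSectionU φ w ((quasiSplit F E c 2).toAdelic (weylLongU (c : E →+* E) (rfl : (StdForm.antidiagonal 2).over E = (StdForm.antidiagonal 2).over E)) *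
        (v : (quasiSplit F E c 2).Adelic) * (g * y))) (νG.prod ν))
    (hcontM : ContinuousOn (fun w : ℂ => ∫ v : ↥(adelicUnipotent F E c 2), flatSectionU φ w ((quasiSplit F E c 2).toAdelic (weylLongU (c : E →+* E)
      (rfl : (StdForm.antidiagonal 2).over E = (StdForm.antidiagonal 2).over E)) * ((v : (quasiSplit F E c 2).Adelic) * g)) ∂ν) {w : ℂ | 1 < w.re})
    (hMne : ∃ w₁ : ℂ, 1 < w₁.re ∧ ∫ v : ↥(adelicUnipotent F E c 2), flatSectionU φ w₁ ((quasiSplit F E c 2).toAdelic (weylLongU (c : E →+* E)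
      (rfl : (StdForm.antidiagonal 2).over E = (StdForm.antidiagonal 2).over E)) * ((v : (quasiSplit F E c 2).Adelic) * g)) ∂ν ≠ 0) (t : ℝ) :
    s (1 / 2 - t * Complex.I) = s (1 / 2 + t * Complex.I) := by
  have h1 := chi_symbol_symm_of_selfDual hc hc1 νG ν hsd hK'U hφ hφm h s hs hR g hint hcontM hMne (1 / 2 + t * Complex.I)
  rw [h1]
  congr 1
  ring

end Summit.HodgeConjecture.HodgeConjecture.Cruxes.H413.K2E1ChiSymbolWeylSymmetrySelfDualU2

end
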